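import Summits.Ventures.HodgeRepro.Transport
import Summits.Ventures.HodgeRepro.Primitive

/-!
# Transport of the right action and of primitivity along group isomorphisms

Blind re-derivation cell `pub-hodge-repro`, seat `typer` (gen 2).  Completes `Transport.lean` for the
notions of `Primitive.lean`: right translates, right stabilisers and primitivity are carried along
`e : G ≃* G'` (so that an abstract-group statement mentioning "primitive" also reduces to `Groups.lean`).
-/

open Finset
open scoped Pointwise

namespace HodgeRepro

variable {G G' : Type*} [Group G] [Group G']

/-- Transport commutes with right translation: `e (Φ h) = (e Φ) (e h)`. -/
theorem mapSet_rmul (e : G ≃* G') (Φ : Finset G) (h : G) :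
    mapSet e (rmul Φ h) = rmul (mapSet e Φ) (e h) := by
  ext x
  rw [mem_mapSet, mem_rmul, mem_rmul, mem_mapSet, map_mul, map_inv, MulEquiv.symm_apply_apply]

/-- Membership in the right stabiliser is transported. -/
theorem mem_rstab_mapSet_iff (e : G ≃* G') (Φ : Finset G) (h : G) :
    e h ∈ rstab (mapSet e Φ) ↔ h ∈ rstab Φ := by
  rw [mem_rstab, mem_rstab, ← mapSet_rmul]
  exact ⟨fun H => mapSet_injective e H, fun H => by rw [H]⟩

/-- Primitivity is transported. -/
theorem isPrimitive_mapSet_iff (e : G ≃* G') (Φ : Finset G) :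
    IsPrimitive (mapSet e Φ) ↔ IsPrimitive Φ := by
  constructor
  · intro hP h hh
    have := hP (e h) (by rw [← mapSet_rmul, hh])
    exact e.injective (by rw [this, map_one])
  · intro hP h' hh'
    obtain ⟨h, rfl⟩ := e.surjective h'
    rw [← mapSet_rmul] at hh'
    rw [hP h (mapSet_injective e hh'), map_one]

/-- Being induced from a subgroup is transported (`H ≤ rstab Φ` ⇔ `H.map e ≤ rstab (e Φ)`). -/
theorem isInducedFrom_mapSet_iff (e : G ≃* G') (Φ : Finset G) (H : Subgroup G) :
    IsInducedFrom (mapSet e Φ) (H.map e.toMonoidHom) ↔ IsInducedFrom Φ H := by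
  unfold IsInducedFrom
  constructor
  · intro hle h hh
    have := hle (Subgroup.mem_map_of_mem e.toMonoidHom hh)
    exact (mem_rstab_mapSet_iff e Φ h).1 this
  · intro hle h' hh'
    obtain ⟨h, hh, rfl⟩ := Subgroup.mem_map.1 hh'
    exact (mem_rstab_mapSet_iff e Φ h).2 (hle hh)

end HodgeRepro
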